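import Summits.CriticalPhenomena.CardyFormulaZ2.Theorems.CardyComplexConeParafermionToSLESixFamiliesDiamondDefs
import HarnessLib

/-!
# The rotated frame of a marked diamond and the supporting-line lemma behind `IsBdrySegment`
# (line `potential-darboux-picard-diamond`, S1′ TURN, part 1)

Crux `ParafermionToSLESixFamilies` (stmt-CriticalPhenomena-11389), line `potential-darboux-picard-diamond`,
stub `stub_exactPotentialTracePh` (S1′), clause (TURN): "consecutive boundary segments `p → v → q` turn by
the Schwarz–Christoffel rule of `∫(φ′)^{1/3}`, `τ(v,q) = τ(p,v) · exp(i (⅔·∠_v + π/3·[v is a mark]))`".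
This is pure geometry of the predicate `IsBdrySegment D p q` (`…DiamondDefs.lean`) on a MARKED DIAMOND
(`IsMarkedDiamond D`: the carrier is the open rectangle `|Re w| < α`, `|Im w| < β` in the rotated frame
`w = (z - c) e^{-iπ/4}`). This file is the frame bookkeeping; the sequels `…DiamondTracePos.lean` (boundary
positions, mark steps) and `…DiamondTraceTurn.lean` (`τ` and the turning rule) build on it.

* `dRot c z = (z - c) e^{-iπ/4}` and its inverse `dRotInv` (`dRot_dRotInv`, `dRotInv_dRot`,
  `dRot_injective`); `orient_dRot` — the orientation form `(z - p) conj(q - p)` is frame invariant;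
* `dCorner`, `dDir`, `dLen`, `dParam α β k s = dCorner k + s · dDir k` — the four corners
  `(-α,-β), (α,-β), (α,β), (-α,β)`, counter-clockwise unit directions `1, i, -1, -i`, side lengths, and the
  point at arc length `s` on side `k`;
* `side_of_support` — **the supporting-line lemma**: if `P ≠ Q` lie in the closed rectangle and the open
  rectangle lies strictly to the left of the line `P → Q` (`0 < Im((W - P) conj(Q - P))`), then `[P, Q]`
  runs counter-clockwise along ONE side: `P = dParam k s`, `Q = dParam k t`, `0 ≤ s < t ≤ dLen k` (the
  functional `W ↦ Im((W - P) conj(Q - P))` is minimised on the closed rectangle exactly at `P` and `Q`,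
  and a nonzero linear functional is minimised on a rectangle along a vertex or a side;
  `le_neg_abs_of_forall_lt`);
* `abs_le_of_mem_closure`, `bdry_of_mem_frontier` — the closed diamond lies in the closed frame
  rectangle, its frontier off the open one;
* `segData_of_isBdrySegment` / `isBdrySegment_sideData` (registered, `--supports` the crux) — for a
  Dobrushin domain whose carrier is the open rotated rectangle, `IsBdrySegment D p q` yields these side
  data for `dRot c p`, `dRot c q`.

Everything here is elementary real arithmetic; nothing is cited.
-/

noncomputable section

namespace Summit.CriticalPhenomena.CardyFormulaZ2.Cruxes.ParafermionToSLESixFamilies.PotentialDarbouxPicardDiamond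

open Set Metric Complex
open Literature.Probability.RandomPlanarGeometry

/-! ## The rotated frame -/

/-- The frame rotation of `IsMarkedDiamond`: `w = (z - c) e^{-iπ/4}`. -/
def dRot (c z : ℂ) : ℂ := (z - c) * exp (-(Real.pi / 4 : ℝ) * I)

/-- The inverse frame map: `z = c + w e^{iπ/4}`. -/
def dRotInv (c w : ℂ) : ℂ := c + w * exp ((Real.pi / 4 : ℝ) * I)

/-- The two frame phases are inverse to each other. -/
theorem exp_neg_quarter_mul_exp_quarter :
    exp (-(Real.pi / 4 : ℝ) * I) * exp ((Real.pi / 4 : ℝ) * I) = 1 := by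
  rw [← Complex.exp_add]
  convert Complex.exp_zero using 2
  push_cast
  ring

/-- `dRot c (dRotInv c w) = w`. -/
@[simp] theorem dRot_dRotInv (c w : ℂ) : dRot c (dRotInv c w) = w := by
  unfold dRot dRotInv
  rw [add_sub_cancel_left, mul_assoc, mul_comm (exp _) (exp _), exp_neg_quarter_mul_exp_quarter, mul_one]

/-- `dRotInv c (dRot c z) = z`. -/
@[simp] theorem dRotInv_dRot (c z : ℂ) : dRotInv c (dRot c z) = z := by
  unfold dRot dRotInv
  rw [mul_assoc, exp_neg_quarter_mul_exp_quarter, mul_one, add_sub_cancel]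

/-- The frame map is injective. -/
theorem dRot_injective (c : ℂ) : Function.Injective (dRot c) := fun z w h => by
  rw [← dRotInv_dRot c z, h, dRotInv_dRot]

/-- Differences in the frame: `dRot c z - dRot c p = (z - p) e^{-iπ/4}`. -/
theorem dRot_sub (c z p : ℂ) : dRot c z - dRot c p = (z - p) * exp (-(Real.pi / 4 : ℝ) * I) := by
  unfold dRot; ring

/-- The frame phase is unimodular: `e^{-iπ/4} · conj(e^{-iπ/4}) = 1`. -/
theorem exp_neg_quarter_mul_conj :
    exp (-(Real.pi / 4 : ℝ) * I) * (starRingEnd ℂ) (exp (-(Real.pi / 4 : ℝ) * I)) = 1 := by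
  rw [Complex.mul_conj, Complex.normSq_eq_norm_sq]
  have : ‖exp (-(Real.pi / 4 : ℝ) * I)‖ = 1 := by
    rw [show (-(Real.pi / 4 : ℝ) : ℂ) * I = ((-(Real.pi / 4) : ℝ) : ℂ) * I by push_cast; ring]
    exact norm_exp_ofReal_mul_I _
  rw [this]; norm_num

/-- **The orientation form is frame invariant**: `(z - p) conj(q - p)` is unchanged under `dRot c`. -/
theorem orient_dRot (c z p q : ℂ) :
    (dRot c z - dRot c p) * (starRingEnd ℂ) (dRot c q - dRot c p) = (z - p) * (starRingEnd ℂ) (q - p) := by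
  rw [dRot_sub, dRot_sub, map_mul]
  calc (z - p) * exp (-(Real.pi / 4 : ℝ) * I) * ((starRingEnd ℂ) (q - p) * (starRingEnd ℂ) (exp (-(Real.pi / 4 : ℝ) * I)))
      = (z - p) * (starRingEnd ℂ) (q - p) *
          (exp (-(Real.pi / 4 : ℝ) * I) * (starRingEnd ℂ) (exp (-(Real.pi / 4 : ℝ) * I))) := by ring
    _ = (z - p) * (starRingEnd ℂ) (q - p) := by rw [exp_neg_quarter_mul_conj, mul_one]

/-! ## Sides of the rectangle `|Re w| ≤ α`, `|Im w| ≤ β` as parametrised segments -/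

/-- The four corners of the rectangle, counter-clockwise from `(-α, -β)`. -/
def dCorner (α β : ℝ) (k : Fin 4) : ℂ :=
  ![(-α : ℂ) + (-β : ℂ) * I, (α : ℂ) + (-β : ℂ) * I, (α : ℂ) + (β : ℂ) * I, (-α : ℂ) + (β : ℂ) * I] k

/-- The counter-clockwise unit directions of the four sides: `1, i, -1, -i`. -/
def dDir (k : Fin 4) : ℂ := ![1, I, -1, -I] k

/-- The lengths of the four sides: `2α, 2β, 2α, 2β`. -/
def dLen (α β : ℝ) (k : Fin 4) : ℝ := ![2 * α, 2 * β, 2 * α, 2 * β] k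

/-- The point at arc length `s` along side `k`: `dCorner k + s · dDir k`. -/
def dParam (α β : ℝ) (k : Fin 4) (s : ℝ) : ℂ := dCorner α β k + (s : ℂ) * dDir k

variable {α β : ℝ}

/-! ## The supporting-line lemma -/

/-- A linear functional that is exceeded on the whole open rectangle is at most its infimum there:
if `L₀ < A x + B y` for all `|x| < α`, `|y| < β`, then `L₀ ≤ -|A| α - |B| β`. -/
theorem le_neg_abs_of_forall_lt (hα : 0 < α) (hβ : 0 < β) {A B L₀ : ℝ}
    (h : ∀ x y : ℝ, |x| < α → |y| < β → L₀ < A * x + B * y) : L₀ ≤ -(|A| * α) - |B| * β := by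
  by_contra hlt
  rw [not_le] at hlt
  set S := |A| * α + |B| * β with hS
  have hS0 : 0 ≤ S := by positivity
  set ε := L₀ + S with hε
  have hε0 : 0 < ε := by rw [hε]; linarith
  -- a dilation factor `t ∈ [1/2, 1)` with `(1 - t) S < ε`
  set t := max (1 / 2 : ℝ) (1 - ε / (2 * S + 1)) with ht
  have ht0 : 0 < t := lt_of_lt_of_le (by norm_num) (le_max_left _ _)
  have ht1 : t < 1 := by
    rw [ht, max_lt_iff]
    refine ⟨by norm_num, ?_⟩
    have : 0 < ε / (2 * S + 1) := div_pos hε0 (by linarith)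
    linarith
  have htS : (1 - t) * S < ε := by
    have h1t : 1 - t ≤ ε / (2 * S + 1) := by
      have := le_max_right (1 / 2 : ℝ) (1 - ε / (2 * S + 1))
      rw [← ht] at this; linarith
    calc (1 - t) * S ≤ ε / (2 * S + 1) * S := mul_le_mul_of_nonneg_right h1t hS0
      _ < ε := by
        rw [div_mul_eq_mul_div, div_lt_iff₀ (by linarith)]
        nlinarith
  -- the test point
  have hAx : A * (-(A / |A|) * α * t) = -(|A| * α) * t := by
    rcases eq_or_ne A 0 with rfl | hA
    · simp
    · have : A * (A / |A|) = |A| := by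
        rw [mul_div_assoc', div_eq_iff (abs_ne_zero.2 hA)]; exact (abs_mul_abs_self A).symm
      calc A * (-(A / |A|) * α * t) = -(A * (A / |A|)) * α * t := by ring
        _ = -(|A| * α) * t := by rw [this]; ring
  have hBy : B * (-(B / |B|) * β * t) = -(|B| * β) * t := by
    rcases eq_or_ne B 0 with rfl | hB
    · simp
    · have : B * (B / |B|) = |B| := by
        rw [mul_div_assoc', div_eq_iff (abs_ne_zero.2 hB)]; exact (abs_mul_abs_self B).symm
      calc B * (-(B / |B|) * β * t) = -(B * (B / |B|)) * β * t := by ring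
        _ = -(|B| * β) * t := by rw [this]; ring
  have habsA : |-(A / |A|) * α * t| < α := by
    rw [abs_mul, abs_mul, abs_neg, abs_of_pos hα, abs_of_pos ht0]
    have : abs (A / abs A) ≤ 1 := by
      rw [abs_div, abs_abs]
      exact div_self_le_one _
    calc abs (A / abs A) * α * t ≤ 1 * α * t := by gcongr
      _ < α := by nlinarith
  have habsB : |-(B / |B|) * β * t| < β := by
    rw [abs_mul, abs_mul, abs_neg, abs_of_pos hβ, abs_of_pos ht0]
    have : abs (B / abs B) ≤ 1 := by
      rw [abs_div, abs_abs]
      exact div_self_le_one _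
    calc abs (B / abs B) * β * t ≤ 1 * β * t := by gcongr
      _ < β := by nlinarith
  have key := h _ _ habsA habsB
  rw [hAx, hBy] at key
  have : L₀ < -t * S := by rw [hS]; linarith
  nlinarith

/-- The orientation form in coordinates: `Im((W - P) conj u) = (W - P).im u.re - (W - P).re u.im`. -/
theorem orient_im (W P u : ℂ) :
    ((W - P) * (starRingEnd ℂ) u).im = -u.im * W.re + u.re * W.im - (-u.im * P.re + u.re * P.im) := by
  simp [Complex.mul_im, Complex.sub_re, Complex.sub_im]; ring

/-- **The supporting-line lemma.** If `P ≠ Q` lie in the closed rectangle `|Re| ≤ α`, `|Im| ≤ β` and the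
open rectangle lies strictly to the left of the line `P → Q`, then `[P, Q]` runs counter-clockwise along
one side: `P = dParam k s`, `Q = dParam k t` with `0 ≤ s < t ≤ dLen k`. -/
theorem side_of_support (hα : 0 < α) (hβ : 0 < β) {P Q : ℂ} (hne : P ≠ Q) (hPre : |P.re| ≤ α)
    (hPim : |P.im| ≤ β) (hQre : |Q.re| ≤ α) (hQim : |Q.im| ≤ β)
    (h : ∀ W : ℂ, |W.re| < α → |W.im| < β → 0 < ((W - P) * (starRingEnd ℂ) (Q - P)).im) :
    ∃ (k : Fin 4) (s t : ℝ), 0 ≤ s ∧ s < t ∧ t ≤ dLen α β k ∧ P = dParam α β k s ∧ Q = dParam α β k t := by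
  set u := Q - P with hu
  set A := -u.im with hA
  set B := u.re with hB
  -- the functional `L(W) = A Re W + B Im W` exceeds `L(P)` on the open rectangle and `L(Q) = L(P)`
  have hL : ∀ x y : ℝ, |x| < α → |y| < β → A * P.re + B * P.im < A * x + B * y := by
    intro x y hx hy
    have := h ⟨x, y⟩ (by simpa using hx) (by simpa using hy)
    rw [orient_im] at this
    simp only at this
    linarith
  have hLQ : A * Q.re + B * Q.im = A * P.re + B * P.im := by
    have h0 : ((Q - P) * (starRingEnd ℂ) (Q - P)).im = 0 := by rw [Complex.mul_conj]; simp
    rw [orient_im] at h0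
    linarith
  have hmin := le_neg_abs_of_forall_lt hα hβ hL
  rw [abs_le] at hPre hPim hQre hQim
  -- termwise minimality at `P` and at `Q`
  have hAP : -(|A| * α) ≤ A * P.re := by
    have : |A * P.re| ≤ |A| * α := by rw [abs_mul]; exact mul_le_mul_of_nonneg_left (abs_le.2 hPre) (abs_nonneg _)
    linarith [neg_abs_le (A * P.re)]
  have hBP : -(|B| * β) ≤ B * P.im := by
    have : |B * P.im| ≤ |B| * β := by rw [abs_mul]; exact mul_le_mul_of_nonneg_left (abs_le.2 hPim) (abs_nonneg _)
    linarith [neg_abs_le (B * P.im)]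
  have hAQ : -(|A| * α) ≤ A * Q.re := by
    have : |A * Q.re| ≤ |A| * α := by rw [abs_mul]; exact mul_le_mul_of_nonneg_left (abs_le.2 hQre) (abs_nonneg _)
    linarith [neg_abs_le (A * Q.re)]
  have hBQ : -(|B| * β) ≤ B * Q.im := by
    have : |B * Q.im| ≤ |B| * β := by rw [abs_mul]; exact mul_le_mul_of_nonneg_left (abs_le.2 hQim) (abs_nonneg _)
    linarith [neg_abs_le (B * Q.im)]
  have hAPe : A * P.re = -(|A| * α) := by linarith
  have hBPe : B * P.im = -(|B| * β) := by linarith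
  have hAQe : A * Q.re = -(|A| * α) := by linarith
  have hBQe : B * Q.im = -(|B| * β) := by linarith
  -- the sign pattern of `(A, B)` picks the side
  have hu0 : u ≠ 0 := sub_ne_zero.2 hne.symm
  have key : ∀ {C x y γ : ℝ}, C * x = -(|C| * γ) → C * y = -(|C| * γ) → 0 < C → x = -γ ∧ y = -γ := by
    intro C x y γ hx hy hC
    rw [abs_of_pos hC] at hx hy
    constructor <;> nlinarith
  have key' : ∀ {C x y γ : ℝ}, C * x = -(|C| * γ) → C * y = -(|C| * γ) → C < 0 → x = γ ∧ y = γ := by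
    intro C x y γ hx hy hC
    rw [abs_of_neg hC] at hx hy
    constructor <;> nlinarith
  rcases lt_trichotomy B 0 with hB0 | hB0 | hB0
  · -- `u` points west: top side, `P.im = Q.im = β`
    obtain ⟨hP2, hQ2⟩ := key' hBPe hBQe hB0
    have hA0 : A = 0 := by
      by_contra hA0
      rcases lt_or_gt_of_ne hA0 with hA0 | hA0
      · obtain ⟨hP1, hQ1⟩ := key' hAPe hAQe hA0
        exact hne (Complex.ext (by rw [hP1, hQ1]) (by rw [hP2, hQ2]))
      · obtain ⟨hP1, hQ1⟩ := key hAPe hAQe hA0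
        exact hne (Complex.ext (by rw [hP1, hQ1]) (by rw [hP2, hQ2]))
    have hure : Q.re - P.re < 0 := by
      have h1 : B = Q.re - P.re := by rw [hB, hu]; simp
      linarith
    refine ⟨2, α - P.re, α - Q.re, by linarith, by linarith, by simp [dLen]; linarith, ?_, ?_⟩ <;>
      refine Complex.ext ?_ ?_ <;> simp [dParam, dCorner, dDir] <;> linarith
  · -- `B = 0`: `u` is vertical
    have hA0 : A ≠ 0 := by
      intro hA0
      apply hu0
      refine Complex.ext ?_ ?_
      · rw [hB] at hB0; simpa using hB0
      · have : u.im = 0 := by rw [hA] at hA0; linarith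
        simpa using this
    rcases lt_or_gt_of_ne hA0 with hA0' | hA0'
    · -- `A < 0`, `u.im > 0`: right side going north
      obtain ⟨hP1, hQ1⟩ := key' hAPe hAQe hA0'
      have huim : 0 < Q.im - P.im := by
        have h1 : A = -(Q.im - P.im) := by rw [hA, hu]; simp
        linarith
      refine ⟨1, P.im + β, Q.im + β, by linarith, by linarith, by simp [dLen]; linarith, ?_, ?_⟩ <;>
        refine Complex.ext ?_ ?_ <;> simp [dParam, dCorner, dDir] <;> linarith
    · -- `A > 0`, `u.im < 0`: left side going south
      obtain ⟨hP1, hQ1⟩ := key hAPe hAQe hA0'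
      have huim : Q.im - P.im < 0 := by
        have h1 : A = -(Q.im - P.im) := by rw [hA, hu]; simp
        linarith
      refine ⟨3, β - P.im, β - Q.im, by linarith, by linarith, by simp [dLen]; linarith, ?_, ?_⟩ <;>
        refine Complex.ext ?_ ?_ <;> simp [dParam, dCorner, dDir] <;> linarith
  · -- `u` points east: bottom side
    obtain ⟨hP2, hQ2⟩ := key hBPe hBQe hB0
    have hA0 : A = 0 := by
      by_contra hA0
      rcases lt_or_gt_of_ne hA0 with hA0 | hA0
      · obtain ⟨hP1, hQ1⟩ := key' hAPe hAQe hA0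
        exact hne (Complex.ext (by rw [hP1, hQ1]) (by rw [hP2, hQ2]))
      · obtain ⟨hP1, hQ1⟩ := key hAPe hAQe hA0
        exact hne (Complex.ext (by rw [hP1, hQ1]) (by rw [hP2, hQ2]))
    have hure : 0 < Q.re - P.re := by
      have h1 : B = Q.re - P.re := by rw [hB, hu]; simp
      linarith
    refine ⟨0, P.re + α, Q.re + α, by linarith, by linarith, by simp [dLen]; linarith, ?_, ?_⟩ <;>
      refine Complex.ext ?_ ?_ <;> simp [dParam, dCorner, dDir] <;> linarith

/-! ## From `IsBdrySegment` on a marked diamond to side data in the frame -/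

section Diamond

variable {D : DobrushinDomain} {c : ℂ}

/-- The frame map is continuous. -/
theorem continuous_dRot (c : ℂ) : Continuous (dRot c) := by
  unfold dRot; fun_prop

/-- **The closed diamond lies in the closed frame rectangle**: points of the closure of the carrier have
frame coordinates `|Re| ≤ α`, `|Im| ≤ β`. -/
theorem abs_le_of_mem_closure (hD : D.carrier = {z | |(dRot c z).re| < α ∧ |(dRot c z).im| < β}) {z : ℂ}
    (hz : z ∈ closure D.carrier) : |(dRot c z).re| ≤ α ∧ |(dRot c z).im| ≤ β := by
  have hc := continuous_dRot c
  have hclosed : IsClosed {z : ℂ | |(dRot c z).re| ≤ α ∧ |(dRot c z).im| ≤ β} := by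
    apply IsClosed.inter
    · exact isClosed_le (continuous_abs.comp (Complex.continuous_re.comp hc)) continuous_const
    · exact isClosed_le (continuous_abs.comp (Complex.continuous_im.comp hc)) continuous_const
  have hsub : D.carrier ⊆ {z : ℂ | |(dRot c z).re| ≤ α ∧ |(dRot c z).im| ≤ β} := by
    rw [hD]; intro z hz; exact ⟨hz.1.le, hz.2.le⟩
  exact closure_minimal hsub hclosed hz

/-- **Frontier points are boundary points of the frame rectangle** (closed rectangle, not open). -/
theorem bdry_of_mem_frontier (hD : D.carrier = {z | |(dRot c z).re| < α ∧ |(dRot c z).im| < β}) {z : ℂ}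
    (hz : z ∈ frontier D.carrier) :
    |(dRot c z).re| ≤ α ∧ |(dRot c z).im| ≤ β ∧ ¬ (|(dRot c z).re| < α ∧ |(dRot c z).im| < β) := by
  obtain ⟨h1, h2⟩ := abs_le_of_mem_closure hD (frontier_subset_closure hz)
  refine ⟨h1, h2, fun h => ?_⟩
  have hzD : z ∈ D.carrier := by rw [hD]; exact h
  have := D.isOpen.inter_frontier_eq
  exact (Set.eq_empty_iff_forall_notMem.1 this) z ⟨hzD, hz⟩

/-- **Side data of an oriented boundary segment of a marked diamond.** For a Dobrushin domain whose
carrier is the open frame rectangle, `IsBdrySegment D p q` forces `[p, q]` to run counter-clockwise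
along one side: in the frame, `p = dParam k s`, `q = dParam k t` with `0 ≤ s < t ≤ dLen k`. Only the
non-degeneracy, `segment ⊆ frontier` (at the endpoints) and the orientation clause are used: the line
through `p, q` supports the convex carrier, and a supporting line of a rectangle meets it in a vertex or
a side. -/
theorem segData_of_isBdrySegment (hα : 0 < α) (hβ : 0 < β)
    (hD : D.carrier = {z | |(dRot c z).re| < α ∧ |(dRot c z).im| < β}) {p q : ℂ} (h : IsBdrySegment D p q) :
    ∃ (k : Fin 4) (s t : ℝ), 0 ≤ s ∧ s < t ∧ t ≤ dLen α β k ∧ dRot c p = dParam α β k s ∧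
      dRot c q = dParam α β k t := by
  obtain ⟨hne, hseg, -, -, horient⟩ := h
  have hp := abs_le_of_mem_closure hD (frontier_subset_closure (hseg (left_mem_segment ℝ p q)))
  have hq := abs_le_of_mem_closure hD (frontier_subset_closure (hseg (right_mem_segment ℝ p q)))
  refine side_of_support hα hβ (fun heq => hne (dRot_injective c heq)) hp.1 hp.2 hq.1 hq.2 fun W hWre hWim => ?_
  have hz : dRotInv c W ∈ D.carrier := by
    rw [hD]; refine ⟨?_, ?_⟩ <;> simpa
  have := horient _ hz
  rwa [← orient_dRot c, dRot_dRotInv] at this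

end Diamond

/-- **Registered form** (the frame rotation written out as in `IsMarkedDiamond`): for a Dobrushin domain
whose carrier is the open rotated rectangle with centre `c` and half-widths `α, β > 0`, every oriented
boundary segment `IsBdrySegment D p q` lies counter-clockwise on one side of the rectangle. -/
theorem isBdrySegment_sideData : ∀ (D : DobrushinDomain) (c : ℂ) (α β : ℝ), 0 < α → 0 < β → D.carrier = {z | |((z - c) * exp (-(Real.pi / 4 : ℝ) * I)).re| < α ∧ |((z - c) * exp (-(Real.pi / 4 : ℝ) * I)).im| < β} → ∀ p q : ℂ, IsBdrySegment D p q → ∃ (k : Fin 4) (s t : ℝ), 0 ≤ s ∧ s < t ∧ t ≤ dLen α β k ∧ dRot c p = dParam α β k s ∧ dRot c q = dParam α β k t := by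
  intro D c α β hα hβ hD p q h
  exact segData_of_isBdrySegment hα hβ hD h

end Summit.CriticalPhenomena.CardyFormulaZ2.Cruxes.ParafermionToSLESixFamilies.PotentialDarbouxPicardDiamond

end
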